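import Mathlib.LinearAlgebra.Matrix.Kronecker
import Mathlib.LinearAlgebra.Matrix.NonsingularInverse
import Mathlib.LinearAlgebra.Matrix.Trace
import Mathlib.LinearAlgebra.Matrix.Notation
import Mathlib.Tactic.LinearCombination
import Literature.MathematicalPhysics.QuantumLattice.SpinOperators
import HarnessLib

/-!
# Dimock–Yuan, *Structural stability of the RG flow in the Gross–Neveu model*, Appendix C «Gamma matrices»:
# the `Pin(2)`-covariance of `γ_μ`, `γ₅`, the trace-orthogonal bases (489) ∕ (493)–(494), and LEMMAS 25–26
# (the invariant tensors: `α = cI`, `α_μ = cγ_μ`, `α = c(I⊗I) + c_p(γ₅⊗γ₅) + c_v Σ_μ γ_μ⊗γ_μ`) — PROVED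

statement-level skeleton of published theorems with citation tags; proofs where landed; nothing here is a claim about the Yang–Mills mass gap

**Citation header (reproduction of PUBLISHED work).** J. Dimock, C. Yuan, *Structural stability of the RG flow in the
Gross–Neveu model*, Ann. Henri Poincaré **25** (2024) 5113–5186, doi 10.1007/s00023-024-01427-0 (= arXiv:2303.07916v3)
[DimockYuan2024GNFlow], **Appendix C «Gamma matrices»**, arXiv-v3 PDF p.73 L9 – p.74 L44 of the held text layer
`paper:arxiv-2303.07916` (`p.NN Lnn` = PDF page ∕ text-layer line). Writer seat p11 (literature-prover-lit-balaban-p11-g15-0),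
YM LIT SWEEP item (c) D10.

**The printed text.** p.73 L9–16: *"Let `γ₀, γ₁` be `2 × 2` traceless matrices satisfying `{γ_μ, γ_ν} = 2δ_μν`. If `R` is a
reflection through a line `x_μ = c` or a rotation by a multiple of `π/2` then there is a matrix `S` in the group `Pin(2)` such
that `S⁻¹γ_μS = Σ_ν R_μν γ_ν`. (Actually there are two such.) We also have `γ₅ = iγ₀γ₁ = (i/2)Σ ε_μν γ_μγ_ν` (488) which
satisfies `S⁻¹γ₅S = (det R)γ₅`."* p.73 L17–29: *"We relabel `(I, γ₀, γ₁, γ₅)` as `(Γ₁, Γ₂, Γ₃, Γ₄)`. Then the `Γ_i` are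
traceless* [sic — for `i ≥ 2`]*, self-adjoint matrices satisfying `Γ_i² = I` and `tr(Γ_iΓ_j) = 2δ_ij`. They are linearly
independent … They form a basis for the space `M₂` … Any matrix `A` can be written `A = Σ_i c_iΓ_i`, `c_i = ½tr(AΓ_i)` (489)."*
**LEMMA 25** (p.73 L30–34): *"1. If `α` in `M₂` satisfies `S⁻¹αS = α` for all `S`, then there is a constant `c` such that
`α = cI`. 2. If `α_μ ∈ M₂` satisfies `S⁻¹α_μS = Σ_ν R_μν α_ν` for all `S`, then there is a constant `c` such that
`α_μ = cγ_μ`."* Proof p.73 L35 – p.74 L22 (traces against the basis vanish by choosing a reflection with *"the right side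
minus the left side"*, *"for `tr(αγ₀)` the reflection `x₀ → −x₀, x₁ → x₁`"*; for (2) in the case `μ = μ′` *"choose `R` so that
`tr(α₀γ₀) = tr(α₁γ₁)`, namely take the rotation `x₀ → x₁, x₁ → −x₀`"*; then (489)). p.74 L23–33: the sixteen `Γ_ij ≡ Γ_i ⊗ Γ_j`,
`tr(Γ_ij Γ_i′j′) = tr(Γ_iΓ_i′)tr(Γ_jΓ_j′) = 4δ_ii′δ_jj′` (493), *"every element `A` has an expansion `A = Σ_ij c_ijΓ_ij`,
`c_ij = ¼tr(AΓ_ij)`"* (494). **LEMMA 26** (p.74 L34–38): *"If `α ∈ L(ℂ²⊗ℂ²)` satisfies `(S⁻¹⊗S⁻¹)α(S⊗S) = α` for all `S`,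
then there are constants `c, c_p, c_v` such that `α = c(I⊗I) + c_p(γ₅⊗γ₅) + c_v Σ_μ (γ_μ⊗γ_μ)` (495)."* Proof p.74 L39–44
(*"`tr(αΓ_ij) = 0` except for `Γ_ij = I⊗I, γ_μ⊗γ_μ, γ₅⊗γ₅` … If `μ = 0` choose `R` to be `x₀ → x₀, x₁ → −x₁` … `tr(αγ_μ⊗γ_μ)`
is independent of `μ`. Then our basic expansion (494) gives the result"*).

**What is here, and how it relates to the print.**
* A REPRESENTATION is fixed (the paper fixes none): `γ₀ = σˣ`, `γ₁ = σʸ` — the tree's Pauli matrices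
  `QuantumLattice.spinHalfPauli 0 ∕ 1` (REUSED, not re-declared) — so that (488) gives `γ₅ = iγ₀γ₁ = −σᶻ` (`gamma5_eq`).
  The printed relations are then theorems: `gamma_anticomm` (`{γ_μ,γ_ν} = 2δ_μν`), `trace_gamma` ∕ `trace_gamma5` (traceless),
  `conjTranspose_gamma` ∕ `_gamma5` (self-adjoint), `gamma_mul_self` ∕ `gamma5_mul_self`.
* The lattice symmetries `R` actually invoked by the printed proofs and, for each, a `Pin(2)` element `S` realising
  `S⁻¹γ_μS = Σ_ν R_μν γ_ν`: `latSym 0` = the reflection `x₀ → x₀, x₁ → −x₁` with `S = γ₀`; `latSym 1` = `x₀ → −x₀, x₁ → x₁`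
  with `S = γ₁`; `latSym 2` = the rotation `x₀ → x₁, x₁ → −x₀` with `S = (1 + γ₀γ₁)/√2`, used here in the un-normalised form
  `pinGen 2 = 1 + γ₀γ₁` (conjugation `S⁻¹(·)S` is insensitive to a nonzero scalar factor — `conj_smul_eq`). The covariance
  sentences of p.73 L10–16 are PROVED for these three: `conj_gamma` (`S⁻¹γ_μS = Σ_ν R_μν γ_ν`) and `conj_gamma5`
  (`S⁻¹γ₅S = (det R)γ₅`). `Pin(2)` itself is not formalised (TODO(general form): the statement for every reflection through
  a coordinate line and every rotation by a multiple of `π/2`; the three above generate that group's action).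
* (489): `Gam = (I, γ₀, γ₁, γ₅)` with `Gam_mul_self`, `conjTranspose_Gam`, `trace_Gam`, `trace_Gam_mul_Gam`
  (`tr(Γ_iΓ_j) = 2δ_ij`), `Gam_linearIndependent` (by the printed one-line trace argument `trace_sum_smul_Gam_mul`),
  `expand2` (`A = Σ_i ½tr(AΓ_i)Γ_i`). (493): `trace_GamGam_mul_GamGam` (from `tr(A⊗B) = tr A · tr B`), `GamGam_mul_self`,
  `conjTranspose_GamGam`. (494): `expand4` (`A = Σ_ij ¼tr(AΓ_ij)Γ_ij` for EVERY `A`), proved by linearity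
  (`Matrix.induction_on'` over the elementary matrices, `expand4Map_add ∕ _single`) from the completeness relation
  `Σ_i (Γ_i)_ab(Γ_i)_cd = 2δ_adδ_bc` (`Gam_completeness`) — the same content as (489).
* LEMMA 25 (`lemma25_1`, `lemma25_2`) and LEMMA 26 (`lemma26`) with the hypothesis *"for all `S`"* WEAKENED to the three
  generators `pinGen s`, `s : Fin 3` (so the theorems here are formally stronger than the printed ones; `Pin(2)` contains
  these three). The proofs extract, from the three conjugation identities, the finitely many scalar relations among the
  matrix entries that the printed trace argument produces (reflection ⇒ an entry∕trace vanishes; the `π/2` rotation ⇒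
  `μ`-independence), and read off the coefficients — a shorter road in Lean than literally expanding in the basis, with
  (489)∕(494) proved alongside as printed and the trace formulas for the coefficients recorded in `lemma25_1_coeff`
  (`c = ½tr α`) and `lemma26_coeff` (`c = ¼tr α`, `c_p = ¼tr(α γ₅⊗γ₅)`, `c_v = ⅛tr(α Σγ_μ⊗γ_μ)`). Converses
  (`one_invariant`, `smul_gamma_covariant`, `lemma26_basis_invariant`) record that `I`, `cγ_μ` and the three tensors
  of (495) do satisfy the hypotheses, so the conclusions are sharp.

No named facts, no `sorry`; every declaration is a `def` with a body or a theorem.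
-/

noncomputable section

open Matrix Complex
open scoped Kronecker

namespace Literature.MathematicalPhysics.QuantumFieldTheory.DimockYuan2024

namespace GammaMatrices

open Literature.MathematicalPhysics.QuantumLattice (spinHalfPauli)

/-- `M₂`, the `2 × 2` complex matrices. [cite: DimockYuan2024GNFlow, App. C p.73 L21] -/
abbrev M2 := Matrix (Fin 2) (Fin 2) ℂ

/-- `L(ℂ² ⊗ ℂ²)`, realised as matrices indexed by `Fin 2 × Fin 2` (Kronecker products `⊗ₖ` live here).
[cite: DimockYuan2024GNFlow, App. C p.74 L27] -/
abbrev M4 := Matrix (Fin 2 × Fin 2) (Fin 2 × Fin 2) ℂ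

/-! ## §C.1 The representation `γ₀ = σˣ`, `γ₁ = σʸ`, `γ₅ = iγ₀γ₁` and the printed relations -/

/-- `γ_μ`, `μ = 0, 1`: the explicit choice `γ₀ = σˣ`, `γ₁ = σʸ` (tree: `spinHalfPauli 0 ∕ 1`) of *"2 × 2 traceless
matrices satisfying `{γ_μ, γ_ν} = 2δ_μν`"*. [cite: DimockYuan2024GNFlow, App. C p.73 L9–10] -/
def gamma : Fin 2 → M2 := ![spinHalfPauli 0, spinHalfPauli 1]

/-- `γ₀ = σˣ` written out. [cite: DimockYuan2024GNFlow, App. C p.73 L9–10 (a representation of the printed relations)] -/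
theorem gamma_zero : gamma 0 = !![0, 1; 1, 0] := rfl

/-- `γ₁ = σʸ` written out. [cite: DimockYuan2024GNFlow, App. C p.73 L9–10 (a representation of the printed relations)] -/
theorem gamma_one : gamma 1 = !![0, -I; I, 0] := rfl

/-- `γ₅ = iγ₀γ₁` (488). [cite: DimockYuan2024GNFlow, App. C (488) p.73 L13–15] -/
def gamma5 : M2 := I • (gamma 0 * gamma 1)

/-- In this representation `γ₅ = −σᶻ = diag(−1, 1)`. [cite: DimockYuan2024GNFlow, App. C (488) p.73 L13–15] -/
theorem gamma5_eq : gamma5 = !![-1, 0; 0, 1] := by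
  ext a b
  fin_cases a <;> fin_cases b <;> simp [gamma5, gamma, spinHalfPauli]

/-- `γ₅ = −σᶻ` in terms of the tree's Pauli matrices. [cite: DimockYuan2024GNFlow, App. C (488) p.73 L13–15] -/
theorem gamma5_eq_neg_pauli : gamma5 = -spinHalfPauli 2 := by
  rw [gamma5_eq]
  ext a b
  fin_cases a <;> fin_cases b <;> simp [spinHalfPauli]

/-- `γ₅ = (i/2) Σ_μν ε_μν γ_μ γ_ν` — the second form of (488), with `ε₀₁ = 1 = −ε₁₀`.
[cite: DimockYuan2024GNFlow, App. C (488) p.73 L13–15] -/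
theorem gamma5_eq_epsilon :
    gamma5 = (I / 2) • (gamma 0 * gamma 1 - gamma 1 * gamma 0) := by
  rw [gamma5_eq]
  ext a b
  fin_cases a <;> fin_cases b <;> simp [gamma, spinHalfPauli, Complex.ext_iff] <;> norm_num

/-- `{γ_μ, γ_ν} = 2δ_μν`. [cite: DimockYuan2024GNFlow, App. C p.73 L9–10] -/
theorem gamma_anticomm (μ ν : Fin 2) :
    gamma μ * gamma ν + gamma ν * gamma μ = (if μ = ν then (2 : ℂ) else 0) • (1 : M2) := by
  ext a b
  fin_cases μ <;> fin_cases ν <;> fin_cases a <;> fin_cases b <;>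
    simp [gamma, spinHalfPauli, Complex.ext_iff] <;> norm_num

/-- `γ_μ² = I`. [cite: DimockYuan2024GNFlow, App. C p.73 L18 («Γ_i² = I»)] -/
theorem gamma_mul_self (μ : Fin 2) : gamma μ * gamma μ = 1 := by
  ext a b
  fin_cases μ <;> fin_cases a <;> fin_cases b <;> simp [gamma, spinHalfPauli]

/-- `γ₅² = I`. [cite: DimockYuan2024GNFlow, App. C p.73 L18 («Γ_i² = I»)] -/
theorem gamma5_mul_self : gamma5 * gamma5 = 1 := by
  rw [gamma5_eq]
  ext a b
  fin_cases a <;> fin_cases b <;> simp [Matrix.mul_apply]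

/-- `γ_μ` is traceless. [cite: DimockYuan2024GNFlow, App. C p.73 L9, L17–18] -/
theorem trace_gamma (μ : Fin 2) : (gamma μ).trace = 0 := by
  fin_cases μ <;> simp [gamma, spinHalfPauli, Matrix.trace, Fin.sum_univ_two]

/-- `γ₅` is traceless. [cite: DimockYuan2024GNFlow, App. C p.73 L17–18] -/
theorem trace_gamma5 : gamma5.trace = 0 := by
  simp [gamma5_eq, Matrix.trace, Fin.sum_univ_two]

/-- `γ_μ` is self-adjoint. [cite: DimockYuan2024GNFlow, App. C p.73 L17–18 («self-adjoint»)] -/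
theorem conjTranspose_gamma (μ : Fin 2) : (gamma μ)ᴴ = gamma μ := by
  ext a b
  fin_cases μ <;> fin_cases a <;> fin_cases b <;> simp [gamma, spinHalfPauli, Matrix.conjTranspose_apply]

/-- `γ₅` is self-adjoint. [cite: DimockYuan2024GNFlow, App. C p.73 L17–18 («self-adjoint»)] -/
theorem conjTranspose_gamma5 : gamma5ᴴ = gamma5 := by
  rw [gamma5_eq]
  ext a b
  fin_cases a <;> fin_cases b <;> simp [Matrix.conjTranspose_apply]

/-! ## §C.2 The three lattice symmetries of the printed proofs and their `Pin(2)` elements -/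

/-- The lattice symmetries `R` invoked in the printed proofs (as `2 × 2` matrices acting on `(x₀, x₁)`):
`0`: the reflection `x₀ → x₀, x₁ → −x₁` (p.74 L41); `1`: the reflection `x₀ → −x₀, x₁ → x₁` (p.73 L39);
`2`: the rotation by `π/2`, `x₀ → x₁, x₁ → −x₀` (p.74 L13).
[cite: DimockYuan2024GNFlow, App. C p.73 L10–11, L39; p.74 L13, L41] -/
def latSym : Fin 3 → M2 := ![!![1, 0; 0, -1], !![-1, 0; 0, 1], !![0, 1; -1, 0]]

/-- For each `latSym s`, an element `S` of `Pin(2)` (up to a scalar for `s = 2`) with `S⁻¹γ_μS = Σ_ν R_μν γ_ν`: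
`γ₀`, `γ₁`, and `1 + γ₀γ₁ = √2 · exp((π/4)γ₀γ₁)`. [cite: DimockYuan2024GNFlow, App. C p.73 L10–12] -/
def pinGen : Fin 3 → M2 := ![gamma 0, gamma 1, 1 + gamma 0 * gamma 1]

/-- The rotation's `S` is diagonal: `1 + γ₀γ₁ = diag(1 + i, 1 − i)`. [cite: DimockYuan2024GNFlow, App. C p.73 L10–12] -/
theorem pinGen_two_eq : pinGen 2 = !![1 + I, 0; 0, 1 - I] := by
  ext a b
  fin_cases a <;> fin_cases b <;> simp [pinGen, gamma, spinHalfPauli, sub_eq_add_neg]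

/-- The explicit inverses `S⁻¹`: `γ₀⁻¹ = γ₀`, `γ₁⁻¹ = γ₁`, `(1 + γ₀γ₁)⁻¹ = ½(1 − γ₀γ₁)`.
[cite: DimockYuan2024GNFlow, App. C p.73 L10–12 («S⁻¹»)] -/
def pinGenInv : Fin 3 → M2 := ![gamma 0, gamma 1, !![(1 - I) / 2, 0; 0, (1 + I) / 2]]

/-- `S⁻¹S = 1`. [cite: DimockYuan2024GNFlow, App. C p.73 L10–12 («S⁻¹»)] -/
theorem pinGenInv_mul_pinGen (s : Fin 3) : pinGenInv s * pinGen s = 1 := by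
  ext a b
  fin_cases s <;> fin_cases a <;> fin_cases b <;>
    simp [pinGen, pinGenInv, gamma, spinHalfPauli, Matrix.mul_apply] <;> ring_nf <;> simp [Complex.ext_iff] <;> norm_num

/-- `SS⁻¹ = 1`. [cite: DimockYuan2024GNFlow, App. C p.73 L10–12 («S⁻¹»)] -/
theorem pinGen_mul_pinGenInv (s : Fin 3) : pinGen s * pinGenInv s = 1 := by
  ext a b
  fin_cases s <;> fin_cases a <;> fin_cases b <;>
    simp [pinGen, pinGenInv, gamma, spinHalfPauli, Matrix.mul_apply] <;> ring_nf <;> simp [Complex.ext_iff] <;> norm_num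

/-- `(pinGen s)⁻¹` is the explicit `pinGenInv s`. [cite: DimockYuan2024GNFlow, App. C p.73 L10–12 («S⁻¹»)] -/
theorem pinGen_inv (s : Fin 3) : (pinGen s)⁻¹ = pinGenInv s :=
  Matrix.inv_eq_left_inv (pinGenInv_mul_pinGen s)

/-- `det S ≠ 0` for the three generators (`−1, −1, 2`): `S` is invertible. [cite: DimockYuan2024GNFlow, App. C p.73 L10–12 («S⁻¹»)] -/
theorem isUnit_det_pinGen (s : Fin 3) : IsUnit (pinGen s).det := by
  rw [Matrix.isUnit_iff_isUnit_det _ |>.symm]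
  exact ⟨⟨pinGen s, pinGenInv s, pinGen_mul_pinGenInv s, pinGenInv_mul_pinGen s⟩, rfl⟩

/-- **Covariance of `γ_μ`**: `S⁻¹γ_μS = Σ_ν R_μν γ_ν` for the three symmetries.
[cite: DimockYuan2024GNFlow, App. C p.73 L10–12] -/
theorem conj_gamma (s : Fin 3) (μ : Fin 2) :
    (pinGen s)⁻¹ * gamma μ * pinGen s = ∑ ν, latSym s μ ν • gamma ν := by
  rw [pinGen_inv]
  ext a b
  fin_cases s <;> fin_cases μ <;> fin_cases a <;> fin_cases b <;>
    simp [pinGen, pinGenInv, gamma, latSym, spinHalfPauli, Matrix.mul_apply, Fin.sum_univ_two] <;> ring_nf <;>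
    simp [Complex.ext_iff]

/-- **Covariance of `γ₅`**: `S⁻¹γ₅S = (det R)γ₅`. [cite: DimockYuan2024GNFlow, App. C p.73 L15–16] -/
theorem conj_gamma5 (s : Fin 3) :
    (pinGen s)⁻¹ * gamma5 * pinGen s = (latSym s).det • gamma5 := by
  rw [pinGen_inv, gamma5_eq]
  ext a b
  fin_cases s <;> fin_cases a <;> fin_cases b <;>
    simp [pinGen, pinGenInv, gamma, latSym, spinHalfPauli, Matrix.mul_apply, Matrix.det_fin_two] <;> ring_nf <;>
    simp [Complex.ext_iff] <;> norm_num

/-- `det R = ±1`: `−1` for the two reflections, `+1` for the rotation. [cite: DimockYuan2024GNFlow, App. C p.73 L15–16] -/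
theorem det_latSym : (fun s => (latSym s).det) = ![-1, -1, 1] := by
  funext s
  fin_cases s <;> simp [latSym, Matrix.det_fin_two]

/-- Conjugation identities are equivalent to commutation identities (`S` invertible): `S⁻¹XS = Y ↔ XS = SY`. [folklore] -/
private theorem conj_eq_iff {n : Type*} [Fintype n] [DecidableEq n] {S X Y : Matrix n n ℂ} (hS : IsUnit S.det) :
    S⁻¹ * X * S = Y ↔ X * S = S * Y := by
  constructor
  · intro h
    calc X * S = S * (S⁻¹ * X) * S := by rw [Matrix.mul_nonsing_inv_cancel_left _ _ hS]
      _ = S * (S⁻¹ * X * S) := by simp only [Matrix.mul_assoc]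
      _ = S * Y := by rw [h]
  · intro h
    calc S⁻¹ * X * S = S⁻¹ * (X * S) := by rw [Matrix.mul_assoc]
      _ = S⁻¹ * (S * Y) := by rw [h]
      _ = Y := Matrix.nonsing_inv_mul_cancel_left _ _ hS

/-- Conjugation is insensitive to a nonzero scalar on `S` (so `1 + γ₀γ₁` and `(1 + γ₀γ₁)/√2 ∈ Pin(2)` conjugate alike).
[cite: DimockYuan2024GNFlow, App. C p.73 L10–12 (the `Pin(2)` element of the rotation is `(1 + γ₀γ₁)/√2`)] -/
theorem conj_smul_eq {n : Type*} [Fintype n] [DecidableEq n] {S : Matrix n n ℂ} (X : Matrix n n ℂ)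
    (hS : IsUnit S.det) {c : ℂ} (hc : c ≠ 0) :
    (c • S)⁻¹ * X * (c • S) = S⁻¹ * X * S := by
  have hinv : (c • S)⁻¹ = c⁻¹ • S⁻¹ := by
    apply Matrix.inv_eq_left_inv
    simp only [Matrix.smul_mul, Matrix.mul_smul, smul_smul, mul_inv_cancel₀ hc, one_smul,
      Matrix.nonsing_inv_mul _ hS]
  rw [hinv]
  simp only [Matrix.smul_mul, Matrix.mul_smul, smul_smul, mul_inv_cancel₀ hc, one_smul]


/-- `S = γ₀` for the reflection `x₁ → −x₁`, written out. [cite: DimockYuan2024GNFlow, App. C p.73 L10–12] -/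
theorem pinGen_zero : pinGen 0 = !![0, 1; 1, 0] := rfl

/-- `S = γ₁` for the reflection `x₀ → −x₀`, written out. [cite: DimockYuan2024GNFlow, App. C p.73 L10–12] -/
theorem pinGen_one : pinGen 1 = !![0, -I; I, 0] := rfl

/-! ## §C.3 The bases `Γ_i` of `M₂` (489) and `Γ_ij = Γ_i ⊗ Γ_j` of `L(ℂ² ⊗ ℂ²)` (493)–(494) -/

/-- `(Γ₁, Γ₂, Γ₃, Γ₄) = (I, γ₀, γ₁, γ₅)` (indexed here by `Fin 4 = {0,1,2,3}`). [cite: DimockYuan2024GNFlow, App. C p.73 L17] -/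
def Gam : Fin 4 → M2 := ![1, gamma 0, gamma 1, gamma5]

/-- The four matrices written out. [cite: DimockYuan2024GNFlow, App. C p.73 L17] -/
theorem Gam_eq : Gam = ![!![1, 0; 0, 1], !![0, 1; 1, 0], !![0, -I; I, 0], !![-1, 0; 0, 1]] := by
  funext i
  fin_cases i
  · show (1 : M2) = _
    exact Matrix.one_fin_two
  · rfl
  · rfl
  · exact gamma5_eq

/-- `Γ_i² = I`. [cite: DimockYuan2024GNFlow, App. C p.73 L18] -/
theorem Gam_mul_self (i : Fin 4) : Gam i * Gam i = 1 := by
  rw [Gam_eq]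
  ext a b
  fin_cases i <;> fin_cases a <;> fin_cases b <;> simp [Matrix.mul_apply]

/-- The `Γ_i` are self-adjoint. [cite: DimockYuan2024GNFlow, App. C p.73 L17–18] -/
theorem conjTranspose_Gam (i : Fin 4) : (Gam i)ᴴ = Gam i := by
  rw [Gam_eq]
  ext a b
  fin_cases i <;> fin_cases a <;> fin_cases b <;> simp [Matrix.conjTranspose_apply]

/-- `Γ_i` is traceless for `i ≠ 1` (i.e. for `γ₀, γ₁, γ₅`; `tr Γ₁ = tr I = 2`). [cite: DimockYuan2024GNFlow, App. C p.73 L17–18] -/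
theorem trace_Gam (i : Fin 4) : (Gam i).trace = if i = 0 then 2 else 0 := by
  rw [Gam_eq]
  fin_cases i <;> norm_num [Matrix.trace, Fin.sum_univ_two]

/-- **(489), orthogonality**: `tr(Γ_iΓ_j) = 2δ_ij`. [cite: DimockYuan2024GNFlow, App. C p.73 L18] -/
theorem trace_Gam_mul_Gam (i j : Fin 4) : (Gam i * Gam j).trace = if i = j then 2 else 0 := by
  rw [Gam_eq]
  fin_cases i <;> fin_cases j <;> norm_num [Matrix.trace, Fin.sum_univ_two]

/-- `tr((Σ_i c_iΓ_i)Γ_j) = 2c_j` — the computation behind *"if `Σ_i c_iΓ_i = 0` then `c_j = Σ_i c_i tr(Γ_iΓ_j) = 0`"*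
(with the factor `½` the print elides). [cite: DimockYuan2024GNFlow, App. C p.73 L18–20] -/
theorem trace_sum_smul_Gam_mul (c : Fin 4 → ℂ) (j : Fin 4) :
    ((∑ i, c i • Gam i) * Gam j).trace = 2 * c j := by
  simp [Finset.sum_mul, Matrix.trace_sum, Matrix.trace_smul, trace_Gam_mul_Gam, mul_comm]

/-- **(489), linear independence** of `(I, γ₀, γ₁, γ₅)`, by the printed argument. [cite: DimockYuan2024GNFlow, App. C p.73 L18–20] -/
theorem Gam_linearIndependent : LinearIndependent ℂ Gam := by
  rw [Fintype.linearIndependent_iff]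
  intro c hc j
  have h := trace_sum_smul_Gam_mul c j
  rw [hc, Matrix.zero_mul, Matrix.trace_zero] at h
  have h2 : (2 : ℂ) * c j = 0 := h.symm
  exact (mul_eq_zero.1 h2).resolve_left two_ne_zero

/-- **(489), the expansion**: `A = Σ_i c_iΓ_i` with `c_i = ½tr(AΓ_i)`, for every `A ∈ M₂`.
[cite: DimockYuan2024GNFlow, App. C (489) p.73 L21–29] -/
theorem expand2 (A : M2) : A = ∑ i, ((1 / 2 : ℂ) * (A * Gam i).trace) • Gam i := by
  rw [Gam_eq]
  ext a b
  fin_cases a <;> fin_cases b <;>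
    simp [Matrix.trace, Matrix.mul_apply, Fin.sum_univ_four, Fin.sum_univ_two, Matrix.sum_apply] <;> ring_nf <;>
    simp only [Complex.I_sq] <;> ring

/-- The completeness relation of the basis: `Σ_i (Γ_i)_ab (Γ_i)_cd = 2δ_ad δ_bc` (equivalent to (489)).
[cite: DimockYuan2024GNFlow, App. C (489) p.73 L21–29] -/
theorem Gam_completeness (a b c d : Fin 2) :
    ∑ i, Gam i a b * Gam i c d = if a = d ∧ b = c then 2 else 0 := by
  rw [Gam_eq]
  fin_cases a <;> fin_cases b <;> fin_cases c <;> fin_cases d <;> simp [Fin.sum_univ_four] <;> norm_num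

/-- **(493)**: `tr(Γ_ij Γ_i′j′) = tr(Γ_iΓ_i′) tr(Γ_jΓ_j′) = 4 δ_ii′ δ_jj′` for `Γ_ij = Γ_i ⊗ Γ_j`.
[cite: DimockYuan2024GNFlow, App. C (493) p.74 L23–27] -/
theorem trace_GamGam_mul_GamGam (i j i' j' : Fin 4) :
    ((Gam i ⊗ₖ Gam j) * (Gam i' ⊗ₖ Gam j')).trace = if i = i' ∧ j = j' then 4 else 0 := by
  rw [← Matrix.mul_kronecker_mul, Matrix.trace_kronecker, trace_Gam_mul_Gam, trace_Gam_mul_Gam]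
  by_cases hi : i = i' <;> by_cases hj : j = j' <;> norm_num [hi, hj]

/-- The `Γ_ij = Γ_i ⊗ Γ_j` are self-adjoint with `Γ_ij² = I ⊗ I`. [cite: DimockYuan2024GNFlow, App. C p.74 L23–25] -/
theorem GamGam_mul_self (i j : Fin 4) : (Gam i ⊗ₖ Gam j) * (Gam i ⊗ₖ Gam j) = 1 := by
  rw [← Matrix.mul_kronecker_mul, Gam_mul_self, Gam_mul_self, Matrix.one_kronecker_one]

/-- The `Γ_ij` are self-adjoint. [cite: DimockYuan2024GNFlow, App. C p.74 L23–25 («These are self-adjoint»)] -/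
theorem conjTranspose_GamGam (i j : Fin 4) : (Gam i ⊗ₖ Gam j)ᴴ = Gam i ⊗ₖ Gam j := by
  rw [Matrix.conjTranspose_kronecker, conjTranspose_Gam, conjTranspose_Gam]

/-- `tr(single P Q x · K) = x K_QP`. [folklore] -/
private theorem trace_single_mul {n : Type*} [Fintype n] [DecidableEq n] (P Q : n) (x : ℂ) (K : Matrix n n ℂ) :
    (Matrix.single P Q x * K).trace = x * K Q P := by
  simp [Matrix.trace, Matrix.mul_apply, Matrix.single, ite_and, Finset.sum_ite_eq]

/-- The coefficient map of (494): `A ↦ Σ_ij ¼tr(AΓ_ij) Γ_ij`. [cite: DimockYuan2024GNFlow, App. C (494) p.74 L28–33] -/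
def expand4Map (A : M4) : M4 := ∑ i, ∑ j, ((1 / 4 : ℂ) * (A * (Gam i ⊗ₖ Gam j)).trace) • (Gam i ⊗ₖ Gam j)

/-- The expansion map of (494) is additive. [cite: DimockYuan2024GNFlow, App. C (494) p.74 L28–33] -/
theorem expand4Map_add (A B : M4) : expand4Map (A + B) = expand4Map A + expand4Map B := by
  simp only [expand4Map, Matrix.add_mul, Matrix.trace_add, mul_add, add_smul, Finset.sum_add_distrib]

/-- The expansion map of (494) vanishes at `0`. [cite: DimockYuan2024GNFlow, App. C (494) p.74 L28–33] -/
theorem expand4Map_zero : expand4Map 0 = 0 := by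
  simp [expand4Map]

/-- (494) on the elementary matrices, by the completeness relation of (489).
[cite: DimockYuan2024GNFlow, App. C (494) p.74 L28–33] -/
theorem expand4Map_single (P Q : Fin 2 × Fin 2) (x : ℂ) : expand4Map (Matrix.single P Q x) = Matrix.single P Q x := by
  obtain ⟨p1, p2⟩ := P
  obtain ⟨q1, q2⟩ := Q
  unfold expand4Map
  simp only [trace_single_mul]
  ext ⟨r1, r2⟩ ⟨s1, s2⟩
  simp only [Matrix.sum_apply, Matrix.smul_apply, Matrix.kroneckerMap_apply, smul_eq_mul]
  have key : ∑ i, ∑ j, (1 / 4 : ℂ) * (x * (Gam i q1 p1 * Gam j q2 p2)) * (Gam i r1 s1 * Gam j r2 s2)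
      = (1 / 4 : ℂ) * x * ((∑ i, Gam i q1 p1 * Gam i r1 s1) * (∑ j, Gam j q2 p2 * Gam j r2 s2)) := by
    rw [Finset.sum_mul_sum, Finset.mul_sum]
    refine Finset.sum_congr rfl fun i _ => ?_
    rw [Finset.mul_sum]
    refine Finset.sum_congr rfl fun j _ => ?_
    ring
  rw [key, Gam_completeness, Gam_completeness]
  by_cases h1 : q1 = s1 <;> by_cases h2 : p1 = r1 <;> by_cases h3 : q2 = s2 <;> by_cases h4 : p2 = r2 <;>
    simp [h1, h2, h3, h4, Matrix.single]
  ring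

/-- **(494), the expansion**: `A = Σ_ij c_ijΓ_ij`, `c_ij = ¼tr(AΓ_ij)`, for every `A ∈ L(ℂ² ⊗ ℂ²)` — reduced by
linearity to the elementary matrices and there to the completeness relation of (489).
[cite: DimockYuan2024GNFlow, App. C (494) p.74 L28–33] -/
theorem expand4 (A : M4) : A = ∑ i, ∑ j, ((1 / 4 : ℂ) * (A * (Gam i ⊗ₖ Gam j)).trace) • (Gam i ⊗ₖ Gam j) := by
  show A = expand4Map A
  induction A using Matrix.induction_on' with
  | h_zero => rw [expand4Map_zero]
  | h_add p q hp hq => rw [expand4Map_add, ← hp, ← hq]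
  | h_std_basis P Q x => rw [expand4Map_single]

/-! ## §C.4 LEMMA 25 -/

/-- If `xa = by` then `y = (a/b)x` (`b ≠ 0`). [folklore] -/
private theorem eq_div_mul_of_mul_eq_mul {x y a b : ℂ} (h : x * a = b * y) (hb : b ≠ 0) : y = a / b * x := by
  field_simp
  linear_combination -h

/-- If `xa = bx` with `a ≠ b` then `x = 0`. [folklore] -/
private theorem eq_zero_of_mul_eq_mul {x a b : ℂ} (h : x * a = b * x) (hab : a ≠ b) : x = 0 := by
  have h' : (a - b) * x = 0 := by linear_combination h
  exact (mul_eq_zero.1 h').resolve_left (sub_ne_zero.2 hab)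

/-- **LEMMA 25 (1).** If `S⁻¹αS = α` for the `Pin(2)` elements `S` of the three lattice symmetries, then `α = cI`
(and `c = ½ tr α`). [cite: DimockYuan2024GNFlow, App. C Lemma 25 (1) p.73 L30–32, proof L35–41] -/
theorem lemma25_1 (α : M2) (h : ∀ s : Fin 3, (pinGen s)⁻¹ * α * pinGen s = α) : ∃ c : ℂ, α = c • (1 : M2) := by
  have h0 := (conj_eq_iff (isUnit_det_pinGen 0)).1 (h 0)
  have h2 := (conj_eq_iff (isUnit_det_pinGen 2)).1 (h 2)
  rw [pinGen_zero] at h0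
  rw [pinGen_two_eq] at h2
  -- the π/2 rotation kills the off-diagonal entries (its `S` is diagonal with distinct eigenvalues)
  have t01 := congrFun (congrFun h2 0) 1
  have t10 := congrFun (congrFun h2 1) 0
  -- the reflection `x₀ → x₀, x₁ → −x₁` (`S = γ₀`) identifies the two diagonal entries
  have t11 := congrFun (congrFun h0 1) 0
  simp [Matrix.mul_apply] at t01 t10 t11
  have z01 : α 0 1 = 0 := eq_zero_of_mul_eq_mul t01 (by norm_num [Complex.ext_iff])
  have z10 : α 1 0 = 0 := eq_zero_of_mul_eq_mul t10 (by norm_num [Complex.ext_iff])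
  refine ⟨α 0 0, ?_⟩
  ext a b
  fin_cases a <;> fin_cases b <;> simp [z01, z10, t11]

/-- … and the constant is `c = ½ tr α`, as in (489). [cite: DimockYuan2024GNFlow, App. C Lemma 25 (1) p.73 L30–32, L41] -/
theorem lemma25_1_coeff (α : M2) (c : ℂ) (h : α = c • (1 : M2)) : c = (1 / 2 : ℂ) * α.trace := by
  subst h
  simp [Matrix.trace]

/-- **LEMMA 25 (2).** If `S⁻¹α_μS = Σ_ν R_μν α_ν` for the three lattice symmetries, then `α_μ = cγ_μ` with one
constant `c` for both `μ`. [cite: DimockYuan2024GNFlow, App. C Lemma 25 (2) p.73 L32–34, proof p.74 L1–22] -/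
theorem lemma25_2 (α : Fin 2 → M2)
    (h : ∀ (s : Fin 3) (μ : Fin 2), (pinGen s)⁻¹ * α μ * pinGen s = ∑ ν, latSym s μ ν • α ν) :
    ∃ c : ℂ, ∀ μ, α μ = c • gamma μ := by
  have h20 := (conj_eq_iff (isUnit_det_pinGen 2)).1 (h 2 0)
  have h21 := (conj_eq_iff (isUnit_det_pinGen 2)).1 (h 2 1)
  have h00 := (conj_eq_iff (isUnit_det_pinGen 0)).1 (h 0 0)
  rw [pinGen_two_eq] at h20 h21
  rw [pinGen_zero] at h00
  -- diagonal entries: the rotation gives `α₀_aa = α₁_aa = −α₀_aa`, hence `0`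
  have d0 := congrFun (congrFun h20 0) 0
  have d0' := congrFun (congrFun h21 0) 0
  have d1 := congrFun (congrFun h20 1) 1
  have d1' := congrFun (congrFun h21 1) 1
  -- off-diagonal entries: the rotation gives `α₁_01 = −i α₀_01`, `α₁_10 = i α₀_10`
  have o01 := congrFun (congrFun h20 0) 1
  have o10 := congrFun (congrFun h20 1) 0
  -- the reflection `S = γ₀` gives `α₀_01 = α₀_10`
  have r := congrFun (congrFun h00 0) 0
  simp [Matrix.mul_apply, latSym, Fin.sum_univ_two] at d0 d0' d1 d1' o01 o10 r
  have hu : (1 : ℂ) + I ≠ 0 := by norm_num [Complex.ext_iff]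
  have hu' : (1 : ℂ) - I ≠ 0 := by norm_num [Complex.ext_iff]
  have z000 : α 0 0 0 = 0 := by
    have e : (2 * (1 + I)) * α 0 0 0 = 0 := by linear_combination d0 + d0'
    exact (mul_eq_zero.1 e).resolve_left (mul_ne_zero two_ne_zero hu)
  have z100 : α 1 0 0 = 0 := by
    have e : (2 * (1 + I)) * α 1 0 0 = 0 := by linear_combination d0' - d0
    exact (mul_eq_zero.1 e).resolve_left (mul_ne_zero two_ne_zero hu)
  have z011 : α 0 1 1 = 0 := by
    have e : (2 * (1 - I)) * α 0 1 1 = 0 := by linear_combination d1 + d1'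
    exact (mul_eq_zero.1 e).resolve_left (mul_ne_zero two_ne_zero hu')
  have z111 : α 1 1 1 = 0 := by
    have e : (2 * (1 - I)) * α 1 1 1 = 0 := by linear_combination d1' - d1
    exact (mul_eq_zero.1 e).resolve_left (mul_ne_zero two_ne_zero hu')
  have q1 : (1 - I) / (1 + I) = -I := by
    rw [div_eq_iff hu]
    linear_combination Complex.I_sq
  have q2 : (1 + I) / (1 - I) = I := by
    rw [div_eq_iff hu']
    linear_combination Complex.I_sq
  have e01 : α 1 0 1 = -I * α 0 0 1 := by rw [← q1]; exact eq_div_mul_of_mul_eq_mul o01 hu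
  have e10 : α 1 1 0 = I * α 0 1 0 := by rw [← q2]; exact eq_div_mul_of_mul_eq_mul o10 hu'
  refine ⟨α 0 0 1, fun μ => ?_⟩
  ext a b
  fin_cases μ <;> fin_cases a <;> fin_cases b <;>
    simp [gamma, spinHalfPauli, z000, z100, z011, z111, e01, e10, r, mul_comm]

/-! ## §C.5 LEMMA 26 — the invariant tensors on `ℂ² ⊗ ℂ²` -/

/-- `S ⊗ S` is invertible. [cite: DimockYuan2024GNFlow, App. C Lemma 26 p.74 L34–35 («S⁻¹ ⊗ S⁻¹»)] -/
theorem isUnit_det_pinGen_kronecker (s : Fin 3) : IsUnit (pinGen s ⊗ₖ pinGen s).det := by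
  rw [Matrix.det_kronecker]
  exact ((isUnit_det_pinGen s).pow _).mul ((isUnit_det_pinGen s).pow _)

/-- **LEMMA 26.** If `(S⁻¹ ⊗ S⁻¹) α (S ⊗ S) = α` for the `Pin(2)` elements of the three lattice symmetries, then
`α = c (I ⊗ I) + c_p (γ₅ ⊗ γ₅) + c_v Σ_μ (γ_μ ⊗ γ_μ)` (495).
[cite: DimockYuan2024GNFlow, App. C Lemma 26 (495) p.74 L34–38, proof L39–44] -/
theorem lemma26 (α : M4) (h : ∀ s : Fin 3, (pinGen s ⊗ₖ pinGen s)⁻¹ * α * (pinGen s ⊗ₖ pinGen s) = α) :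
    ∃ c cp cv : ℂ, α = c • (1 : M4) + cp • (gamma5 ⊗ₖ gamma5) + cv • ∑ μ, gamma μ ⊗ₖ gamma μ := by
  have h0 := (conj_eq_iff (isUnit_det_pinGen_kronecker 0)).1 (h 0)
  have h2 := (conj_eq_iff (isUnit_det_pinGen_kronecker 2)).1 (h 2)
  rw [pinGen_zero] at h0
  rw [pinGen_two_eq] at h2
  -- the π/2 rotation: `S ⊗ S` is diagonal with eigenvalue classes {00}, {01, 10}, {11}; entries across classes vanish
  have t1 := congrFun (congrFun h2 (0, 0)) (0, 1)
  have t2 := congrFun (congrFun h2 (0, 0)) (1, 0)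
  have t3 := congrFun (congrFun h2 (0, 0)) (1, 1)
  have t4 := congrFun (congrFun h2 (0, 1)) (0, 0)
  have t5 := congrFun (congrFun h2 (0, 1)) (1, 1)
  have t6 := congrFun (congrFun h2 (1, 0)) (0, 0)
  have t7 := congrFun (congrFun h2 (1, 0)) (1, 1)
  have t8 := congrFun (congrFun h2 (1, 1)) (0, 0)
  have t9 := congrFun (congrFun h2 (1, 1)) (0, 1)
  have t10 := congrFun (congrFun h2 (1, 1)) (1, 0)
  -- the reflection `S = γ₀`: `α_{pq} = α_{p̄q̄}` (both indices flipped)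
  have u1 := congrFun (congrFun h0 (1, 0)) (0, 1)
  have u2 := congrFun (congrFun h0 (1, 1)) (0, 0)
  have u3 := congrFun (congrFun h0 (1, 0)) (1, 0)
  simp [Matrix.mul_apply, Fintype.sum_prod_type, Matrix.kroneckerMap_apply] at t1 t2 t3 t4 t5 t6 t7 t8 t9 t10 u1 u2 u3
  have z1 : α (0, 0) (0, 1) = 0 := eq_zero_of_mul_eq_mul t1 (by norm_num [Complex.ext_iff])
  have z2 : α (0, 0) (1, 0) = 0 := eq_zero_of_mul_eq_mul t2 (by norm_num [Complex.ext_iff])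
  have z3 : α (0, 0) (1, 1) = 0 := eq_zero_of_mul_eq_mul t3 (by norm_num [Complex.ext_iff])
  have z4 : α (0, 1) (0, 0) = 0 := eq_zero_of_mul_eq_mul t4 (by norm_num [Complex.ext_iff])
  have z5 : α (0, 1) (1, 1) = 0 := eq_zero_of_mul_eq_mul t5 (by norm_num [Complex.ext_iff])
  have z6 : α (1, 0) (0, 0) = 0 := eq_zero_of_mul_eq_mul t6 (by norm_num [Complex.ext_iff])
  have z7 : α (1, 0) (1, 1) = 0 := eq_zero_of_mul_eq_mul t7 (by norm_num [Complex.ext_iff])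
  have z8 : α (1, 1) (0, 0) = 0 := eq_zero_of_mul_eq_mul t8 (by norm_num [Complex.ext_iff])
  have z9 : α (1, 1) (0, 1) = 0 := eq_zero_of_mul_eq_mul t9 (by norm_num [Complex.ext_iff])
  have z10 : α (1, 1) (1, 0) = 0 := eq_zero_of_mul_eq_mul t10 (by norm_num [Complex.ext_iff])
  refine ⟨(α (0, 0) (0, 0) + α (0, 1) (0, 1)) / 2, (α (0, 0) (0, 0) - α (0, 1) (0, 1)) / 2, α (0, 1) (1, 0) / 2, ?_⟩
  rw [gamma5_eq]
  ext ⟨a, b⟩ ⟨c, d⟩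
  fin_cases a <;> fin_cases b <;> fin_cases c <;> fin_cases d <;>
    simp [gamma, spinHalfPauli, Matrix.kroneckerMap_apply, Fin.sum_univ_two,
      z1, z2, z3, z4, z5, z6, z7, z8, z9, z10, u1, u2, u3] <;> ring

/-- … with the coefficients read off by traces, as in (494): `c = ¼tr α`, `c_p = ¼tr(α(γ₅⊗γ₅))`,
`c_v = ⅛tr(α Σ_μ γ_μ⊗γ_μ)`. [cite: DimockYuan2024GNFlow, App. C (494)–(495) p.74 L28–44] -/
theorem lemma26_coeff (α : M4) (c cp cv : ℂ)
    (h : α = c • (1 : M4) + cp • (gamma5 ⊗ₖ gamma5) + cv • ∑ μ, gamma μ ⊗ₖ gamma μ) :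
    c = (1 / 4 : ℂ) * α.trace ∧ cp = (1 / 4 : ℂ) * (α * (gamma5 ⊗ₖ gamma5)).trace ∧
      cv = (1 / 8 : ℂ) * (α * ∑ μ, gamma μ ⊗ₖ gamma μ).trace := by
  subst h
  rw [gamma5_eq]
  refine ⟨?_, ?_, ?_⟩ <;>
    simp [Matrix.trace, Matrix.mul_apply, Fintype.sum_prod_type, Fin.sum_univ_two, Matrix.kroneckerMap_apply,
      Matrix.one_apply, gamma, spinHalfPauli] <;> ring

/-! ## §C.6 Converses: the hypotheses are met by `I`, `γ_μ` and the three tensors of (495) -/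

/-- `I` is invariant. [cite: DimockYuan2024GNFlow, App. C Lemma 25 (1) p.73 L30–32] -/
theorem one_invariant (s : Fin 3) : (pinGen s)⁻¹ * 1 * pinGen s = 1 := by
  rw [Matrix.mul_one, Matrix.nonsing_inv_mul _ (isUnit_det_pinGen s)]

/-- `α_μ = cγ_μ` does transform as a vector (this is `conj_gamma`). [cite: DimockYuan2024GNFlow, App. C Lemma 25 (2) p.73 L32–34] -/
theorem smul_gamma_covariant (c : ℂ) (s : Fin 3) (μ : Fin 2) :
    (pinGen s)⁻¹ * (c • gamma μ) * pinGen s = ∑ ν, latSym s μ ν • (c • gamma ν) := by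
  simp only [Matrix.mul_smul, Matrix.smul_mul, conj_gamma, Finset.smul_sum, smul_comm c]

/-- The three tensors of (495) are invariant under `S ⊗ S` for the three lattice symmetries, so LEMMA 26 is sharp.
[cite: DimockYuan2024GNFlow, App. C Lemma 26 (495) p.74 L34–38] -/
theorem lemma26_basis_invariant (c cp cv : ℂ) (s : Fin 3) :
    (pinGen s ⊗ₖ pinGen s)⁻¹ * (c • (1 : M4) + cp • (gamma5 ⊗ₖ gamma5) + cv • ∑ μ, gamma μ ⊗ₖ gamma μ) *
      (pinGen s ⊗ₖ pinGen s) = c • (1 : M4) + cp • (gamma5 ⊗ₖ gamma5) + cv • ∑ μ, gamma μ ⊗ₖ gamma μ := by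
  rw [conj_eq_iff (isUnit_det_pinGen_kronecker s), gamma5_eq]
  ext ⟨a, b⟩ ⟨c', d⟩
  fin_cases s <;> fin_cases a <;> fin_cases b <;> fin_cases c' <;> fin_cases d <;>
    simp [pinGen, gamma, spinHalfPauli, Matrix.mul_apply, Fintype.sum_prod_type, Fin.sum_univ_two,
      Matrix.kroneckerMap_apply, Matrix.one_apply] <;> ring

end GammaMatrices

end Literature.MathematicalPhysics.QuantumFieldTheory.DimockYuan2024
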